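import Literature.Barriers.PneNP.ApproximationMethodLimit
import Literature.Computability.Complexity.CircuitSemantics
import HarnessLib

/-!
# Barrier `ApproximationMethodLimit`: the method itself is sound (Pich 2024, Prop. 1), proved

Companion proof file (D-0014 append protocol) of
`Literature/Barriers/PneNP/ApproximationMethodLimit.lean`. It DISCHARGES the named fact
`Literature.Barriers.PneNP.ApproximationMethodSound` (Pich 2024, Prop. 1; Razborov 1985/1989):
for every legitimate model `𝓜` of order `n` and every circuit `C` over `{∧₂, ∨₂, ¬}` (tree:
`Literature.Computability.Complexity.Circuit (Fin n)`, straight-line programs, `IsOver deMorganBasis`)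
computing `f`, the symmetric difference of `f` and the approximator `g := [[C̄]] ∈ 𝓜` of the
output is covered by the error sets of the `≤ size C` gate tuples — `M.Covers f C.size`, i.e.
`ρ(f, 𝓜) ≤ Size(f)`.

**The printed proof (Pich 2024, §2.1, Prop. 1, arXiv p. 8).** "Let `C` be a `𝒞`-circuit computing
`f` and `g := C̄ ∈ F_n`. Consider the set of tuples `⟨∘̄ᵢ, B̄₁, …, B̄_{mᵢ}⟩` for all gates `∘ᵢ` of
`C` together with the subcircuits `B₁, …, B_{mᵢ}` which act as inputs of `∘ᵢ`. If `f(x) ≠ g(x)`,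
we can compare computations of `C` and `C̄` on `x`. We start at the output gate of `C` and proceed
to some input of the output gate which preserves the error, if such an input exists. We proceed in
this way until we reach a gate `∘` of `C` such that `∘(D₁(x),…,D_m(x)) ≠ ∘̄(D̄₁(x),…,D̄_m(x))`
but `Dⱼ(x) = D̄ⱼ(x)` … Therefore, `x ∈ δ_∘(D̄₁,…,D̄_m)`."

**Formalisation.** Approximators are computed gate by gate along the straight-line program
(`foldTranscript`, a value-generic copy of `Literature.Computability.Complexity.transcript` with
its gate equation `getD_foldTranscript`), each `∧₂`/`∨₂` gate being replaced by `∧̄`/`∨̄` applied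
to the approximators of its argument wires and every other gate (here: `¬`, with `¬̄ = ¬`) kept
exact (`apxGate`); instead of walking down from the output we take the LEAST gate index at which
the true value and the approximator disagree at `x` (the same gate). One error tuple per gate
(`gateTuple`; a harmless dummy tuple for `¬` gates keeps the count at `size C`).

## Sources

* [Pich2024] §2.1 Def. 2 (approximating circuit) and Prop. 1 with proof (arXiv pp. 7–8) — held.
* [Razborov1989] (origin of the framework; through [Pich2024]).
-/

noncomputable section

namespace Literature.Barriers.PneNP

open Finset Function Literature.Computability.Complexity

variable {n : ℕ}

/-! ### A value-generic transcript along a straight-line program -/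

section FoldTranscript

variable {ι : Type*} {β : Type*} (step : List β → Gate ι → β)

/-- Values of a list of gates computed in program order by `step` from the values so far
(generic form of `Literature.Computability.Complexity.transcript`). [cite: Pich2024, §2.1 Def. 2 (p. 7)] -/
def foldTranscript (vals : List β) (gs : List (Gate ι)) : List β :=
  gs.foldl (fun vs g => vs ++ [step vs g]) vals

/-- `foldTranscript` on a cons. [folklore] -/
theorem foldTranscript_cons (vals : List β) (g : Gate ι) (gs : List (Gate ι)) :
    foldTranscript step vals (g :: gs) = foldTranscript step (vals ++ [step vals g]) gs := rfl

/-- Length of `foldTranscript`. [folklore] -/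
theorem length_foldTranscript : ∀ (vals : List β) (gs : List (Gate ι)),
    (foldTranscript step vals gs).length = vals.length + gs.length
  | vals, [] => by simp [foldTranscript]
  | vals, g :: gs => by
    rw [foldTranscript_cons, length_foldTranscript, List.length_append, List.length_cons,
      List.length_cons, List.length_nil]
    omega

/-- `foldTranscript` over an appended gate. [folklore] -/
theorem foldTranscript_append_singleton (vals : List β) (gs : List (Gate ι)) (g : Gate ι) :
    foldTranscript step vals (gs ++ [g]) =
      foldTranscript step vals gs ++ [step (foldTranscript step vals gs) g] := by
  simp [foldTranscript, List.foldl_append]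

/-- `foldTranscript` extends its seed. [folklore] -/
theorem foldTranscript_prefix (vals : List β) (l : List (Gate ι)) :
    ∃ t, foldTranscript step vals l = vals ++ t := by
  induction l generalizing vals with
  | nil => exact ⟨[], by simp [foldTranscript]⟩
  | cons g l ih =>
    obtain ⟨t, ht⟩ := ih (vals ++ [step vals g])
    exact ⟨step vals g :: t, by rw [foldTranscript_cons, ht]; simp⟩

/-- The transcript of a prefix of the program is a prefix of the transcript. [folklore] -/
theorem foldTranscript_take_prefix (gs : List (Gate ι)) (j : ℕ) (hj : j ≤ gs.length) :
    foldTranscript step [] gs =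
      foldTranscript step [] (gs.take j) ++ (foldTranscript step [] gs).drop j := by
  have hsplit : gs = gs.take j ++ gs.drop j := (List.take_append_drop j gs).symm
  have hfold : foldTranscript step [] gs =
      foldTranscript step (foldTranscript step [] (gs.take j)) (gs.drop j) := by
    conv_lhs => rw [hsplit]
    simp only [foldTranscript, List.foldl_append]
  obtain ⟨t, ht⟩ := foldTranscript_prefix step (foldTranscript step [] (gs.take j)) (gs.drop j)
  have hlen : (foldTranscript step [] (gs.take j)).length = j := by
    rw [length_foldTranscript]; simp; omega
  rw [hfold, ht, List.drop_append_of_le_length hlen.ge, List.drop_of_length_le hlen.le,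
    List.nil_append]

/-- **Gate equations** for a well-formed program and a `step` that reads only the entries its gate
refers to: entry `j` of the transcript is `step` applied to the full transcript and gate `j`.
[cite: Pich2024, §2.1 Def. 2 (p. 7)] -/
theorem getD_foldTranscript (d : β)
    (hstep : ∀ (g : Gate ι) (j : ℕ) (vals₁ vals₂ : List β),
      (∀ (a : Fin g.arity) (m : ℕ), g.args a = .inr m → m < j) →
      (∀ m < j, vals₁.getD m d = vals₂.getD m d) → step vals₁ g = step vals₂ g)
    (Q : Circuit ι) (j : ℕ) (hj : j < Q.gates.length) :
    (foldTranscript step [] Q.gates).getD j d =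
      step (foldTranscript step [] Q.gates) (Q.gates[j]) := by
  set W := foldTranscript step [] Q.gates with hW
  have htake : Q.gates.take (j + 1) = Q.gates.take j ++ [Q.gates[j]] := by
    rw [List.take_add_one, List.getElem?_eq_getElem hj]; rfl
  have hpre := foldTranscript_take_prefix step Q.gates (j + 1) hj
  rw [htake, foldTranscript_append_singleton] at hpre
  have hlenj : (foldTranscript step [] (Q.gates.take j)).length = j := by
    rw [length_foldTranscript]; simp; omega
  have hget : W.getD j d = step (foldTranscript step [] (Q.gates.take j)) (Q.gates[j]) := by
    rw [← hW] at hpre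
    rw [hpre, List.getD_eq_getElem?_getD, List.append_assoc, List.getElem?_append_right hlenj.le,
      hlenj, Nat.sub_self]
    simp
  rw [hget]
  refine hstep _ j _ _ (fun a m ha => Q.wf j hj a m ha) fun m hm => ?_
  have hpre' := foldTranscript_take_prefix step Q.gates j hj.le
  rw [← hW] at hpre'
  rw [hpre', List.getD_eq_getElem?_getD, List.getD_eq_getElem?_getD,
    List.getElem?_append_left (by rw [hlenj]; exact hm)]

end FoldTranscript

/-! ### Approximators of wires and gates -/

/-- The `∧₂` truth table on an arity-`2` gate (positions through `Fin.cast`). [folklore] -/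
def andForm {k : ℕ} (h : k = 2) : (Fin k → Bool) → Bool :=
  fun v => v (Fin.cast h.symm 0) && v (Fin.cast h.symm 1)

/-- The `∨₂` truth table on an arity-`2` gate. [folklore] -/
def orForm {k : ℕ} (h : k = 2) : (Fin k → Bool) → Bool :=
  fun v => v (Fin.cast h.symm 0) || v (Fin.cast h.symm 1)

/-- A gate is an `∧₂` gate. [folklore] -/
def IsAndGate (g : Gate (Fin n)) : Prop := ∃ h : g.arity = 2, g.op = andForm h

/-- A gate is an `∨₂` gate. [folklore] -/
def IsOrGate (g : Gate (Fin n)) : Prop := ∃ h : g.arity = 2, g.op = orForm h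

/-- **Classification of De Morgan gates**: a gate of the basis `{∧₂, ∨₂, ¬}` is an `∧₂` gate, an
`∨₂` gate, or a negation `v ↦ ¬ v₀`. [cite: Pich2024, §3.1 Thm. 2 (p. 9: circuits over {¬, ∨₂, ∧₂})] -/
theorem gate_cases (g : Gate (Fin n)) (hg : g.fn ∈ deMorganBasis) :
    IsAndGate g ∨ IsOrGate g ∨ ∃ h : g.arity = 1, g.op = fun v => !v (Fin.cast h.symm 0) := by
  obtain ⟨k, op, args⟩ := g
  simp only [deMorganBasis, Set.mem_insert_iff, Set.mem_singleton_iff, Gate.fn, GateFn.and,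
    GateFn.or, GateFn.not, Sigma.mk.inj_iff] at hg
  rcases hg with ⟨rfl, hop⟩ | ⟨rfl, hop⟩ | ⟨rfl, hop⟩
  · refine Or.inl ⟨rfl, ?_⟩
    have hop' := eq_of_heq hop
    subst hop'
    funext v
    simp [andForm, Fin.forall_fin_two]
  · refine Or.inr (Or.inl ⟨rfl, ?_⟩)
    have hop' := eq_of_heq hop
    subst hop'
    funext v
    simp [orForm, Fin.exists_fin_two]
  · refine Or.inr (Or.inr ⟨rfl, ?_⟩)
    have hop' := eq_of_heq hop
    subst hop'
    funext v
    rfl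

variable (M : LegitimateModel n)

/-- The approximator of a wire, given the approximators of the earlier gates (inputs are
approximated by themselves, `x̄ᵢ := xᵢ`). [cite: Pich2024, §2.1 Def. 2 (p. 7)] -/
def apxWire (vals : List ((Fin n → Bool) → Bool)) : Fin n ⊕ ℕ → (Fin n → Bool) → Bool
  | .inl i => fun x => x i
  | .inr m => vals.getD m fun _ => false

/-- **The approximating gate** `∘̄(w₁, w₂)`: `∧₂`/`∨₂` gates are replaced by the model's `∧̄`/`∨̄`
applied to the (approximated) argument wires; every other gate — for De Morgan circuits only `¬`,
with `¬̄ = ¬` — is applied exactly. [cite: Pich2024, §2.1 Def. 2 (p. 7) and §3.1 Thm. 2 (p. 9: ¬̄ := ¬)] -/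
def apxGate (g : Gate (Fin n)) (w : Fin g.arity → (Fin n → Bool) → Bool) : (Fin n → Bool) → Bool := by
  classical
  exact if h : IsAndGate g then M.approx .and (w (Fin.cast h.1.symm 0)) (w (Fin.cast h.1.symm 1))
    else if h' : IsOrGate g then M.approx .or (w (Fin.cast h'.1.symm 0)) (w (Fin.cast h'.1.symm 1))
    else fun x => g.op fun a => w a x

/-- The error tuple recorded for a gate (a harmless dummy for non-binary gates). [cite: Pich2024, §2.1 Prop. 1 (p. 8: "the set of tuples ⟨∘̄ᵢ, B̄₁, …⟩ for all gates")] -/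
def gateTuple (g : Gate (Fin n)) (w : Fin g.arity → (Fin n → Bool) → Bool) :
    LegitimateModel.ErrTuple n := by
  classical
  exact if h : IsAndGate g then (.and, w (Fin.cast h.1.symm 0), w (Fin.cast h.1.symm 1))
    else if h' : IsOrGate g then (.or, w (Fin.cast h'.1.symm 0), w (Fin.cast h'.1.symm 1))
    else (.or, fun _ => false, fun _ => false)

/-- **Error localisation at one gate**: if the exact gate applied to the approximated argument
values at `x` differs from the approximating gate at `x`, then `x` lies in the error set of the
gate's tuple. [cite: Pich2024, §2.1 Prop. 1 (p. 8: "Therefore, x ∈ δ_∘(D̄₁,…,D̄_m)")] -/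
theorem mem_errSet_gateTuple (g : Gate (Fin n)) (w : Fin g.arity → (Fin n → Bool) → Bool)
    (x : Fin n → Bool) (hx : g.op (fun a => w a x) ≠ apxGate M g w x) :
    x ∈ M.errSet (gateTuple g w).1 (gateTuple g w).2.1 (gateTuple g w).2.2 := by
  classical
  unfold apxGate at hx
  unfold gateTuple
  by_cases h : IsAndGate g
  · rw [dif_pos h] at hx ⊢
    simp only [LegitimateModel.errSet, mem_filter, mem_univ, true_and]
    obtain ⟨h2, hop⟩ := h
    have hval := congrFun hop (fun a => w a x)
    rw [hval] at hx
    simpa [andForm, Conn.apply] using hx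
  · rw [dif_neg h] at hx ⊢
    by_cases h' : IsOrGate g
    · rw [dif_pos h'] at hx ⊢
      simp only [LegitimateModel.errSet, mem_filter, mem_univ, true_and]
      obtain ⟨h2, hop⟩ := h'
      have hval := congrFun hop (fun a => w a x)
      rw [hval] at hx
      simpa [orForm, Conn.apply] using hx
    · rw [dif_neg h'] at hx
      exact (hx rfl).elim

/-- The components of a gate tuple are argument-wire approximators (or the constant `0`), hence in
`𝓜` when the wires are. [cite: Pich2024, §2.1 Def. 1–2 (p. 7)] -/
theorem gateTuple_mem (g : Gate (Fin n)) (w : Fin g.arity → (Fin n → Bool) → Bool)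
    (hw : ∀ a, w a ∈ M.carrier) :
    (gateTuple g w).2.1 ∈ M.carrier ∧ (gateTuple g w).2.2 ∈ M.carrier := by
  classical
  unfold gateTuple
  split_ifs
  · exact ⟨hw _, hw _⟩
  · exact ⟨hw _, hw _⟩
  · exact ⟨M.const_mem false, M.const_mem false⟩

/-- The approximating gate of a De Morgan gate with arguments in `𝓜` lies in `𝓜`
(`∨̄, ∧̄ : 𝓜² → 𝓜`, and `𝓜` is closed under `¬`). [cite: Pich2024, §2.1 Def. 1–2 (p. 7) and §3.1 Thm. 2 (p. 9)] -/
theorem apxGate_mem (g : Gate (Fin n)) (hg : g.fn ∈ deMorganBasis)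
    (w : Fin g.arity → (Fin n → Bool) → Bool) (hw : ∀ a, w a ∈ M.carrier) :
    apxGate M g w ∈ M.carrier := by
  classical
  unfold apxGate
  by_cases h : IsAndGate g
  · rw [dif_pos h]; exact M.approx_mem _ _ _ (hw _) (hw _)
  · rw [dif_neg h]
    by_cases h' : IsOrGate g
    · rw [dif_pos h']; exact M.approx_mem _ _ _ (hw _) (hw _)
    · rw [dif_neg h']
      rcases gate_cases g hg with ha | ho | ⟨h1, hop⟩
      · exact (h ha).elim
      · exact (h' ho).elim
      · rw [hop]
        exact M.compl_mem _ (hw _)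

/-- The gate step of the approximating transcript. [cite: Pich2024, §2.1 Def. 2 (p. 7)] -/
def apxValue (vals : List ((Fin n → Bool) → Bool)) (g : Gate (Fin n)) : (Fin n → Bool) → Bool :=
  apxGate M g fun a => apxWire vals (g.args a)

/-- The approximating step reads only the entries its gate refers to. [folklore] -/
theorem apxValue_congr (g : Gate (Fin n)) (j : ℕ) (vals₁ vals₂ : List ((Fin n → Bool) → Bool))
    (hg : ∀ (a : Fin g.arity) (m : ℕ), g.args a = .inr m → m < j)
    (h : ∀ m < j, vals₁.getD m (fun _ => false) = vals₂.getD m fun _ => false) :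
    apxValue M vals₁ g = apxValue M vals₂ g := by
  unfold apxValue
  congr 1
  funext a
  cases ha : g.args a with
  | inl i => rfl
  | inr m => simp only [apxWire]; exact h m (hg a m ha)

/-- **The approximating transcript** `Ā` of a circuit: the approximators of all its gates.
[cite: Pich2024, §2.1 Def. 2 (p. 7)] -/
def apxTranscript (C : Circuit (Fin n)) : List ((Fin n → Bool) → Bool) :=
  foldTranscript (apxValue M) [] C.gates

/-- Gate equations of the approximating transcript. [cite: Pich2024, §2.1 Def. 2 (p. 7)] -/
theorem getD_apxTranscript (C : Circuit (Fin n)) (j : ℕ) (hj : j < C.gates.length) :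
    (apxTranscript M C).getD j (fun _ => false) =
      apxGate M (C.gates[j]) fun a => apxWire (apxTranscript M C) ((C.gates[j]).args a) :=
  getD_foldTranscript (apxValue M) (fun _ => false) (fun g j v₁ v₂ hg h => apxValue_congr M g j v₁ v₂ hg h)
    C j hj

/-- Every approximator along a De Morgan circuit lies in `𝓜`. [cite: Pich2024, §2.1 Def. 1–2 (p. 7)] -/
theorem apxWire_mem (C : Circuit (Fin n)) (hB : C.IsOver deMorganBasis) :
    ∀ w : Fin n ⊕ ℕ, apxWire (apxTranscript M C) w ∈ M.carrier := by
  have hlen : (apxTranscript M C).length = C.gates.length := by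
    unfold apxTranscript; rw [length_foldTranscript]; simp
  -- gates, by strong induction on the index
  have key : ∀ j, (apxTranscript M C).getD j (fun _ => false) ∈ M.carrier := by
    intro j
    induction j using Nat.strong_induction_on with
    | _ j ih =>
      by_cases hj : j < C.gates.length
      · rw [getD_apxTranscript M C j hj]
        refine apxGate_mem M _ (hB _ (List.getElem_mem hj)) _ fun a => ?_
        cases ha : (C.gates[j]).args a with
        | inl i => exact M.proj_mem i
        | inr m => exact ih m (C.wf j hj a m ha)
      · rw [List.getD_eq_default _ _ (by rw [hlen]; omega)]
        exact M.const_mem false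
  intro w
  cases w with
  | inl i => exact M.proj_mem i
  | inr m => exact key m

/-! ### The discharge -/

/-- **The approximation method is sound (Pich 2024, Prop. 1; Razborov): `ρ(f, 𝓜) ≤ Size(f)`,
proved.** With `g` the approximator of the output wire and one tuple per gate, every `x` with
`f x ≠ g x` lies in the error set of the least gate at which the true transcript and the
approximating transcript disagree at `x`. [cite: Pich2024, §2.1 Prop. 1 with proof (p. 8)] -/
theorem approximationMethodSound_holds : ApproximationMethodSound := by
  intro n M f C hB hf
  classical
  set A := apxTranscript M C with hA
  set L := C.gates.length with hL
  have hlenA : A.length = L := by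
    rw [hA, hL]; unfold apxTranscript; rw [length_foldTranscript]; simp
  -- the tuples: one per gate
  let tup : Fin L → LegitimateModel.ErrTuple n := fun j =>
    gateTuple (C.gates[j.1]'j.2) fun a => apxWire A ((C.gates[j.1]'j.2).args a)
  refine ⟨apxWire A C.output, apxWire_mem M C hB _, List.ofFn tup, by simp [Circuit.size, hL],
    fun τ hτ => ?_, fun x hx => ?_⟩
  · -- components in `𝓜`
    obtain ⟨j, rfl⟩ := List.mem_ofFn.1 hτ
    exact gateTuple_mem M _ _ fun a => apxWire_mem M C hB _
  · -- error localisation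
    set T := transcript x [] C.gates with hT
    have hlenT : T.length = L := by rw [hT, hL, length_transcript]; simp
    -- the disagreement predicate
    let P : ℕ → Prop := fun j => j < L ∧ T.getD j false ≠ A.getD j (fun _ => false) x
    have hex : ∃ j, P j := by
      have hfx : f x = wireVal x T C.output := by rw [← hf x, eval_eq_wireVal]
      cases hout : C.output with
      | inl i =>
        exfalso; apply hx
        rw [hfx, hout]; rfl
      | inr m =>
        refine ⟨m, C.wf_output m hout, ?_⟩
        rw [hfx, hout] at hx
        simpa [wireVal, apxWire] using hx
    -- the least disagreement
    obtain ⟨j, ⟨hjL, hj⟩, hmin⟩ : ∃ j, P j ∧ ∀ m < j, ¬ P m :=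
      ⟨Nat.find hex, Nat.find_spec hex, fun m hm => Nat.find_min hex hm⟩
    have hagree : ∀ m < j, T.getD m false = A.getD m (fun _ => false) x := by
      intro m hm
      by_contra hne
      exact hmin m hm ⟨hm.trans hjL, hne⟩
    -- gate equations at `j`
    set g := C.gates[j]'hjL with hg
    set w : Fin g.arity → (Fin n → Bool) → Bool := fun a => apxWire A (g.args a) with hw
    have hTj : T.getD j false = g.op fun a => w a x := by
      rw [hT, getD_transcript_eq_gateValue C x j hjL, ← hT]
      unfold gateValue
      congr 1
      funext a
      cases ha : g.args a with
      | inl i => simp [wireVal, hw, apxWire, ha]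
      | inr m =>
        have hm : m < j := C.wf j hjL a m ha
        simp only [wireVal, hw, ha, apxWire]
        exact hagree m hm
    have hAj : A.getD j (fun _ => false) x = apxGate M g w x := by
      rw [hA, getD_apxTranscript M C j hjL]
    rw [hTj, hAj] at hj
    refine ⟨tup ⟨j, hjL⟩, List.mem_ofFn.2 ⟨⟨j, hjL⟩, rfl⟩, ?_⟩
    exact mem_errSet_gateTuple M g w x hj

/-- Hence, with Thm. 2: the method certifies at most `c·n₀·n` for De Morgan circuits — for every
circuit `C` over `{∧₂, ∨₂, ¬}` computing `f`, the number of tuples the method can force is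
`≤ size C`, while `c·n₀·n` tuples always suffice. [cite: Pich2024, §1.1.1 (p. 4) and §3.1 Thm. 2 (p. 9)] -/
theorem ApproximationMethodLimit.covers_min_size (h : ApproximationMethodLimit) :
    ∃ c : ℕ, ∀ (n : ℕ) (M : LegitimateModel n) (f : (Fin n → Bool) → Bool) (C : Circuit (Fin n)),
      C.IsOver deMorganBasis → C.Computes f →
        M.Covers f (min C.size (c * (essentialInputs f).card * n)) := by
  obtain ⟨c, hc⟩ := h
  refine ⟨c, fun n M f C hB hf => ?_⟩
  rcases le_total C.size (c * (essentialInputs f).card * n) with hle | hle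
  · rw [min_eq_left hle]; exact approximationMethodSound_holds n M f C hB hf
  · rw [min_eq_right hle]; exact hc n M f

end Literature.Barriers.PneNP

end
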